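import Mathlib
import Summits.Ventures.PercRepro.TriangleCapThirdOrderTenLocusPieces

/-!
# PercRepro — THE THIRD-ORDER LOCUS ON `(10, 21)`: the `K₄⁻`-free graphs with `21` edges on `10` vertices that are
neither `3`- nor `4`-bipartite and attain `Σ_v d(v)² = 190` are EXACTLY `K_{5,5}` minus a `4`-star (p3, gen 46;
part 199j)

Part 199a bounds them by `190`; the census (kit j316691) has `6,300` maximisers, all `K_{5,5}` minus a `4`-star. The
proof tracks part 199a at equality: the cap and the convexity are strict; a vertex `z` of degree `d ≤ 3` is deleted —
`d = 1`: `D − z = K_{4,5}` with the neighbour of `z` on the `5`-side, so `D` is `5`-bipartite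
(`bipSub_insert_of_nbhd_off`); `d = 2`: equality forces `D − z` at the closed form of `(9, 4, 1)` — `4`-bipartite
(`bipSub_of_closed_form_eq`) — with both neighbours of `z` of degree `5 > 4`, hence on the `4`-side, and `D` would
be `4`-bipartite; `d = 3`: either `Σ' ≤ 148` and the three neighbours of `z` have degree `6` in `D`, which the degree
sequence forbids (`(d − 3)(d − 4) ≥ 0` on the other six vertices: `7 · 21 ≤ 73 + 72` fails, `no_three_six_three`),
or `Σ' = 150` and `D − z` is the `B2` family `K_{4,5}` minus a `2`-star — two neighbours of `z` on its `4`-side, the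
third off it and adjacent to all of the `4`-side (degree `4`), a `K₄⁻` — or the hung `K_{4,4}` — the two neighbours
of `z` of degree `5` are the ends of the hung edge, adjacent, with the hung vertex as a common neighbour, a `K₄⁻`.
`three_diag_third_locus_ten`: `5`-bipartite; `three_diag_third_maximisers_ten`: on `Fin 10`, neither `3`- nor
`4`-bipartite, `Σ_v d(v)² = 190 ↔ ∃ A v, |A| = 5 ∧ BipSub D A ∧ MissingStar D A v`. Axioms: standard.
-/

namespace PercRepro

namespace TriangleCap

namespace C047

open Finset

variable {V : Type*} [Fintype V] [DecidableEq V]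

/-- **THE THIRD-ORDER LOCUS ON `(10, 21)`:** `K₄⁻`-free, `k = 10`, `m = 21`, neither `3`- nor `4`-bipartite, and
`Σ_v d(v)² + 20 = m k` ⇒ `D` is a spanning subgraph of some `K(A, Aᶜ)` with `|A| = 5`. -/
theorem three_diag_third_locus_ten (D : SimpleGraph V) [DecidableRel D.Adj] (hK : K4mFree D)
    (hk : Fintype.card V = 10) (hm : D.edgeFinset.card = 21) (h3 : ¬ ∃ A : Finset V, A.card = 3 ∧ BipSub D A)
    (h4 : ¬ ∃ A : Finset V, A.card = 4 ∧ BipSub D A)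
    (heq : ∑ v, deg D v * deg D v + 20 = D.edgeFinset.card * Fintype.card V) :
    ∃ A : Finset V, A.card = 5 ∧ BipSub D A := by
  rw [hk, hm] at heq
  -- (A) the cap `7` is excluded
  by_cases hx : ∃ x, deg D x + 3 = Fintype.card V
  · obtain ⟨x, hx⟩ := hx
    rcases three_row_cap D hK 0 (by omega) (by omega) x hx with h | ⟨h1, -⟩
    · exact absurd h h3
    · omega
  push Not at hx
  have hcap : ∀ v, deg D v + 3 ≤ Fintype.card V := fun v =>
    deg_add_le_card_of_dense D hK 3 (by norm_num) (by omega)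
      (cap_arith 3 (Fintype.card V) D.edgeFinset.card 0 (by norm_num) (by omega) (by omega)) v
  have hcap' : ∀ v, deg D v + 4 ≤ Fintype.card V := fun v => by
    have h1 := hcap v
    have h2 := hx v
    omega
  have hcap6 : ∀ v, deg D v ≤ 5 + 1 := fun v => by have := hcap' v; omega
  -- (B) the convexity is strict
  by_cases hdeg : ∀ v, 4 ≤ deg D v
  · exfalso
    have h := diag_convex D (by omega) (by omega) hcap' hdeg
    rw [hk, hm] at h
    omega
  push Not at hdeg
  obtain ⟨z, hz⟩ := hdeg
  -- the deletion bookkeeping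
  have hK' := k4mFree_del D hK z
  have hcard' := card_del z
  have hedges' := card_edges_del D z
  have hsq := sum_deg_sq_del D z
  have hNz := card_nbhd_del D z
  obtain ⟨T, hTdef⟩ : ∃ T, ∑ a : {v : V // v ≠ z}, (if D.Adj a.1 z then deg (del D z) a else 0) = T := ⟨_, rfl⟩
  obtain ⟨S', hS'def⟩ : ∃ S', ∑ a : {v : V // v ≠ z}, deg (del D z) a * deg (del D z) a = S' := ⟨_, rfl⟩
  obtain ⟨m', hm'def⟩ : ∃ m', (del D z).edgeFinset.card = m' := ⟨_, rfl⟩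
  obtain ⟨Nz, hNzdef⟩ : ∃ Nz : Finset {v : V // v ≠ z}, Nz = univ.filter (fun a : {v : V // v ≠ z} => D.Adj a.1 z) :=
    ⟨_, rfl⟩
  have hmemNz : ∀ a : {v : V // v ≠ z}, a ∈ Nz ↔ D.Adj a.1 z := fun a => by
    rw [hNzdef, mem_filter]
    simp only [mem_univ, true_and]
  have hTfilt : T = ∑ a ∈ Nz, deg (del D z) a := by rw [← hTdef, hNzdef, sum_filter]
  rw [← hNzdef] at hNz
  rw [hTdef, hS'def] at hsq
  rw [hm'def] at hedges'
  have hcardW' : Fintype.card {v : V // v ≠ z} = 9 := by omega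
  have hdegNz : ∀ a ∈ Nz, deg (del D z) a ≤ 5 := fun a ha =>
    deg_del_le_of_adj D z 5 hcap6 a ((hmemNz a).mp ha)
  have hT15 : T ≤ 5 * Nz.card := by
    rw [hTfilt]
    have := sum_le_sum hdegNz
    rw [sum_const, smul_eq_mul] at this
    omega
  rw [hsq] at heq
  have hd : deg D z = 0 ∨ deg D z = 1 ∨ deg D z = 2 ∨ deg D z = 3 := by omega
  rcases hd with hd0 | hd1 | hd2 | hd3
  · -- `d = 0`: impossible
    exfalso
    have h := four_mul_card_edges_le_sq (del D z) hK' (by omega)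
    rw [hm'def, hcardW'] at h
    omega
  · -- `d = 1`: `D − z = K_{4,5}`, the neighbour of `z` on the `5`-side
    have hm'20 : m' = 20 := by omega
    obtain ⟨A', hA'card, hiff⟩ := k4mFree_extremal_complete (del D z) hK' (by omega)
      (by rw [hm'def, hcardW', hm'20])
    rw [hcardW'] at hA'card
    have hB : BipSub (del D z) A' := fun x y h => ((hiff x y).mp h).1
    by_cases hall : ∀ a : {v : V // v ≠ z}, D.Adj a.1 z → a ∈ A'
    · obtain ⟨B, hBcard, hBsub⟩ := bipSub_lift D z A' hB hall
      exact absurd ⟨B, by rw [hBcard, hA'card], hBsub⟩ h4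
    · push Not at hall
      obtain ⟨w₀, hw₀z, hw₀A⟩ := hall
      have hnone : ∀ a : {v : V // v ≠ z}, D.Adj a.1 z → a ∉ A' := by
        intro a ha
        have : a ∈ Nz := (hmemNz a).mpr ha
        have hw₀ : w₀ ∈ Nz := (hmemNz w₀).mpr hw₀z
        rw [hd1] at hNz
        obtain ⟨b, hb⟩ := card_eq_one.mp hNz
        rw [hb, mem_singleton] at this hw₀
        rw [this, ← hw₀]
        exact hw₀A
      obtain ⟨A, hAcard, hAsub⟩ := bipSub_insert_of_nbhd_off D z A' hB hnone
      exact ⟨A, by rw [hAcard, hA'card], hAsub⟩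
  · -- `d = 2`: equality forces `D − z` at the closed form of `(9, 4, 1)` with both neighbours of degree `5`
    exfalso
    have hm'19 : m' = 19 := by omega
    have hS164 : S' ≤ 164 := by
      rcases one_below_second_order_gen (del D z) hK' 4 (le_refl 4) (by omega)
        (by rw [hm'def, hcardW', hm'19]) with ⟨A', hA'card, hB⟩ | h
      · have := sum_deg_sq_le_of_bipSub (del D z) A' hB 4 1 hA'card (by rw [hm'def, hcardW', hm'19])
          (by omega)
        rw [hS'def, hm'def, hcardW', hm'19] at this
        omega
      · rw [hS'def, hm'def, hcardW', hm'19] at h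
        omega
    rw [hd2] at heq hNz
    have hS'eq : S' = 164 := by omega
    have hT10 : T = 10 := by omega
    obtain ⟨A', hA'card, hB⟩ := bipSub_of_closed_form_eq (del D z) hK' 4 1 (by norm_num) (by omega) (by omega)
      (by rw [hm'def, hcardW', hm'19]) (by rw [hS'def, hm'def, hcardW', hm'19, hS'eq])
    have hall : ∀ a : {v : V // v ≠ z}, D.Adj a.1 z → a ∈ A' := by
      intro a ha
      have h5 := eq_of_sum_eq_card_mul Nz (fun a => deg (del D z) a) 5 hdegNz (by rw [← hTfilt, hT10, hNz])
        a ((hmemNz a).mpr ha)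
      by_contra hA
      have := deg_le_card_of_bipSub (del D z) A' hB a hA
      rw [hA'card] at this
      omega
    obtain ⟨B, hBcard, hBsub⟩ := bipSub_lift D z A' hB hall
    exact h4 ⟨B, by rw [hBcard, hA'card], hBsub⟩
  · -- `d = 3`: `D − z` on the diagonal `(9, 3, 0)`
    exfalso
    have hm'18 : m' = 18 := by omega
    rw [hd3] at heq hNz
    rcases diag_second_order (del D z) hK' (by omega) (by rw [hm'def, hcardW', hm'18])
      with ⟨A', hA'card, hA'⟩ | hgap
    · -- `D − z = K_{3,6}`: the three neighbours of `z` lie on one side — `D` is `3`- or `4`-bipartite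
      have hfull : ∀ {x y : {v : V // v ≠ z}}, x ∈ A' → y ∉ A' → (del D z).Adj x y := fun hx hy =>
        adj_of_bipSub_full (del D z) A' hA' 3 hA'card (by rw [hm'def, hcardW', hm'18]) hx hy
      by_cases hall : ∀ a : {v : V // v ≠ z}, D.Adj a.1 z → a ∈ A'
      · obtain ⟨B, hBcard, hB⟩ := bipSub_lift D z A' hA' hall
        exact h3 ⟨B, by rw [hBcard, hA'card], hB⟩
      · push Not at hall
        obtain ⟨a₀, ha₀z, ha₀A⟩ := hall
        have hoff : ∀ a : {v : V // v ≠ z}, D.Adj a.1 z → a ∉ A' := by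
          intro a₁ ha₁z ha₁A
          have hne01 : a₀ ≠ a₁ := fun h => ha₀A (h ▸ ha₁A)
          obtain ⟨a₂, ha₂z, ha₂0, ha₂1⟩ : ∃ a₂ : {v : V // v ≠ z}, D.Adj a₂.1 z ∧ a₂ ≠ a₀ ∧ a₂ ≠ a₁ := by
            have h2 : 2 < Nz.card := by omega
            obtain ⟨b₁, hb₁, b₂, hb₂, b₃, hb₃, h12, h13, h23⟩ := two_lt_card.mp h2
            rw [hmemNz] at hb₁ hb₂ hb₃
            by_cases e1 : b₁ = a₀ ∨ b₁ = a₁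
            · by_cases e2 : b₂ = a₀ ∨ b₂ = a₁
              · refine ⟨b₃, hb₃, ?_, ?_⟩
                · intro h; rcases e1 with rfl | rfl <;> rcases e2 with rfl | rfl <;>
                    first | exact h12 rfl | exact h13 h | exact h13 h.symm | exact h23 h | exact h23 h.symm
                · intro h; rcases e1 with rfl | rfl <;> rcases e2 with rfl | rfl <;>
                    first | exact h12 rfl | exact h13 h | exact h13 h.symm | exact h23 h | exact h23 h.symm
              · push Not at e2
                exact ⟨b₂, hb₂, e2.1, e2.2⟩
            · push Not at e1
              exact ⟨b₁, hb₁, e1.1, e1.2⟩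
          have h10 : D.Adj a₁.1 a₀.1 := (del_adj D z a₁ a₀).mp (hfull ha₁A ha₀A)
          by_cases ha₂A : a₂ ∈ A'
          · have h20 : D.Adj a₂.1 a₀.1 := (del_adj D z a₂ a₀).mp (hfull ha₂A ha₀A)
            exact not_adj_both D hK (D.adj_symm ha₀z) (D.adj_symm ha₁z) (D.adj_symm h10)
              (fun h => ha₂1 (Subtype.ext h).symm) (D.adj_symm ha₂z) (D.adj_symm h20)
          · have h12' : D.Adj a₁.1 a₂.1 := (del_adj D z a₁ a₂).mp (hfull ha₁A ha₂A)
            exact not_adj_both D hK (D.adj_symm ha₁z) (D.adj_symm ha₀z) h10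
              (fun h => ha₂0 (Subtype.ext h).symm) (D.adj_symm ha₂z) h12'
        obtain ⟨B, hBcard, hB⟩ := bipSub_insert_of_nbhd_off D z A' hA' hoff
        exact h4 ⟨B, by rw [hBcard, hA'card], hB⟩
    · rw [hS'def, hm'def, hcardW', hm'18] at hgap
      have hnb : ¬ ∃ A' : Finset {v : V // v ≠ z}, A'.card = 3 ∧ BipSub (del D z) A' := by
        rintro ⟨A', hA'card, hA'⟩
        have hne' : Nonempty {v : V // v ≠ z} := Fintype.card_pos_iff.mp (by omega)
        obtain ⟨v⟩ := hne'
        have hstar : MissingStar (del D z) A' v := fun x y hx hy hxy =>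
          absurd (adj_of_bipSub_full (del D z) A' hA' 3 hA'card (by rw [hm'def, hcardW', hm'18]) hx hy) hxy
        have h := closed_form_eq_of_missingStar (del D z) A' hA' hstar 3 0 hA'card
          (by rw [hm'def, hcardW', hm'18]) (by omega)
        rw [hS'def, hm'def, hcardW', hm'18] at h
        simp only [zero_mul, add_zero] at h
        omega
      by_cases hS148 : S' + 2 ≤ 150
      · -- `S' ≤ 148`: `T = 15`, the three neighbours of `z` have degree `6`
        have hT15' : T = 15 := by omega
        have h5 := eq_of_sum_eq_card_mul Nz (fun a => deg (del D z) a) 5 hdegNz (by rw [← hTfilt, hT15', hNz])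
        have h6 : ∀ w, D.Adj z w → deg D w = 6 := by
          intro w hw
          have hwz : w ≠ z := fun h => D.irrefl (h ▸ hw)
          have h := deg_del D z ⟨w, hwz⟩
          rw [if_pos (D.adj_symm hw)] at h
          have h5w : deg (del D z) ⟨w, hwz⟩ = 5 := h5 ⟨w, hwz⟩ ((hmemNz ⟨w, hwz⟩).mpr (D.adj_symm hw))
          rw [← h, h5w]
        rw [hd3] at hsq
        exact no_three_six_three D hk hm (by omega) z hd3 h6
      · -- `S' = 150`: the second-order locus at `k = 9`
        have hS150 : S' = 150 := by
          obtain ⟨t, ht⟩ := even_sum_deg_sq (del D z)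
          rw [hS'def] at ht
          omega
        have hT14 : T = 14 := by omega
        have hS'eq : ∑ a : {v : V // v ≠ z}, deg (del D z) a * deg (del D z) a = 150 := by rw [hS'def, hS150]
        -- two neighbours of `z` of degree `5` in `D − z`, and the third
        have hT14' : ∑ a ∈ Nz, deg (del D z) a = 14 := by rw [← hTfilt, hT14]
        rcases three_diag_second_locus_nine (del D z) hK' hcardW' (by rw [hm'def, hm'18]) hnb hS'eq
          with ⟨A', v, hA'card, hB, -⟩ | hH
        · -- the `B2` family: a neighbour off the `4`-side of degree `4`, two on it of degree `5`
          by_cases hall : ∀ a : {v : V // v ≠ z}, D.Adj a.1 z → a ∈ A'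
          · obtain ⟨B, hBcard, hBsub⟩ := bipSub_lift D z A' hB hall
            exact h4 ⟨B, by rw [hBcard, hA'card], hBsub⟩
          · push Not at hall
            obtain ⟨w₀, hw₀z, hw₀A⟩ := hall
            have hw₀Nz : w₀ ∈ Nz := (hmemNz w₀).mpr hw₀z
            have hdw₀ : deg (del D z) w₀ ≤ 4 := by
              have := deg_le_card_of_bipSub (del D z) A' hB w₀ hw₀A
              rw [hA'card] at this
              exact this
            have hrest := add_sum_erase Nz (fun a => deg (del D z) a) hw₀Nz
            rw [hT14'] at hrest
            have hcard2 : (Nz.erase w₀).card = 2 := by rw [card_erase_of_mem hw₀Nz, hNz]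
            have hle2 : ∑ a ∈ Nz.erase w₀, deg (del D z) a ≤ 10 := by
              have := sum_le_sum (fun a (ha : a ∈ Nz.erase w₀) => hdegNz a (mem_of_mem_erase ha))
              rw [sum_const, smul_eq_mul, hcard2] at this
              omega
            have hdw₀4 : deg (del D z) w₀ = 4 := by omega
            have h5 := eq_of_sum_eq_card_mul (Nz.erase w₀) (fun a => deg (del D z) a) 5
              (fun a ha => hdegNz a (mem_of_mem_erase ha)) (by rw [hcard2]; omega)
            obtain ⟨a₁, a₂, h12, hpair⟩ := card_eq_two.mp hcard2
            have ha₁ : a₁ ∈ Nz.erase w₀ := by rw [hpair]; exact mem_insert_self _ _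
            have ha₂ : a₂ ∈ Nz.erase w₀ := by rw [hpair]; exact mem_insert_of_mem (mem_singleton_self _)
            have ha₁A : a₁ ∈ A' := by
              by_contra hA
              have := deg_le_card_of_bipSub (del D z) A' hB a₁ hA
              have := h5 a₁ ha₁
              rw [hA'card] at *
              simp only at *
              omega
            have ha₂A : a₂ ∈ A' := by
              by_contra hA
              have := deg_le_card_of_bipSub (del D z) A' hB a₂ hA
              have := h5 a₂ ha₂
              rw [hA'card] at *
              simp only at *
              omega
            have hadj := adj_all_of_deg_eq_card (del D z) A' hB w₀ hw₀A (by rw [hdw₀4, hA'card])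
            have h1 : D.Adj w₀.1 a₁.1 := (del_adj D z w₀ a₁).mp (hadj a₁ ha₁A)
            have h2 : D.Adj w₀.1 a₂.1 := (del_adj D z w₀ a₂).mp (hadj a₂ ha₂A)
            have ha₁z : D.Adj a₁.1 z := (hmemNz a₁).mp (mem_of_mem_erase ha₁)
            have ha₂z : D.Adj a₂.1 z := (hmemNz a₂).mp (mem_of_mem_erase ha₂)
            exact not_adj_both D hK (D.adj_symm hw₀z) (D.adj_symm ha₁z) h1
              (fun h => h12 (Subtype.ext h)) (D.adj_symm ha₂z) h2
        · -- the hung `K_{4,4}`: the two neighbours of degree `5` are the ends of the hung edge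
          obtain ⟨t₁, ht₁, t₂, ht₂, h12, hd1, hd2⟩ : ∃ t₁ ∈ Nz, ∃ t₂ ∈ Nz, t₁ ≠ t₂ ∧
              deg (del D z) t₁ = 5 ∧ deg (del D z) t₂ = 5 := by
            by_contra hcon
            push Not at hcon
            -- at most one neighbour of degree `5`: `T ≤ 5 + 4 + 4 = 13`
            have hfilt : (Nz.filter (fun a => deg (del D z) a = 5)).card ≤ 1 := by
              apply card_le_one.mpr
              intro a ha b hb
              rw [mem_filter] at ha hb
              by_contra hab
              exact hcon a ha.1 b hb.1 hab ha.2 hb.2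
            have := sum_le_four_mul_card_add_filter Nz (fun a => deg (del D z) a) hdegNz
            rw [hT14', hNz] at this
            omega
          obtain ⟨hadj, w, hw1, hw2⟩ := hungK44_deg_five_adj (del D z) hcardW' hH t₁ t₂ h12 hd1 hd2
          have ht₁z : D.Adj t₁.1 z := (hmemNz t₁).mp ht₁
          have ht₂z : D.Adj t₂.1 z := (hmemNz t₂).mp ht₂
          exact not_adj_both D hK ((del_adj D z t₁ t₂).mp hadj) ((del_adj D z t₁ w).mp hw1)
            ((del_adj D z t₂ w).mp hw2) w.2 ht₁z ht₂z

/-- **THE THIRD-ORDER MAXIMISERS ON `(10, 21)`:** on `Fin 10`, for a `K₄⁻`-free graph with `21` edges that is neither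
`3`- nor `4`-bipartite, `Σ_v d(v)² = 190` iff `D` is `K_{5,5}` minus a `4`-star (`5`-bipartite with a missing
star). -/
theorem three_diag_third_maximisers_ten (D : SimpleGraph (Fin 10)) [DecidableRel D.Adj] (hK : K4mFree D)
    (hm : D.edgeFinset.card = 21) (h3 : ¬ ∃ A : Finset (Fin 10), A.card = 3 ∧ BipSub D A)
    (h4 : ¬ ∃ A : Finset (Fin 10), A.card = 4 ∧ BipSub D A) :
    ∑ v, deg D v * deg D v = 190 ↔
      ∃ (A : Finset (Fin 10)) (v : Fin 10), A.card = 5 ∧ BipSub D A ∧ MissingStar D A v := by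
  have hk : Fintype.card (Fin 10) = 10 := Fintype.card_fin 10
  constructor
  · intro heq
    obtain ⟨A, hAcard, hB⟩ := three_diag_third_locus_ten D hK hk hm h3 h4 (by rw [hk, hm]; omega)
    obtain ⟨v, hv⟩ := exists_missingStar_of_closed_form_eq D A hB 5 4 hAcard (by rw [hk, hm]) (by omega)
      (by rw [hk, hm]; omega)
    exact ⟨A, v, hAcard, hB, hv⟩
  · rintro ⟨A, v, hAcard, hB, hv⟩
    have h := closed_form_eq_of_missingStar D A hB hv 5 4 hAcard (by rw [hk, hm]) (by omega)
    rw [hk, hm] at h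
    omega

end C047

end TriangleCap

end PercRepro
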